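/-
COR-CM (cell pub-hodgecm2 = stage 2 of the Hodge ladder), seat b26 gen 21 (prover-pub-hodgecm2-b26-g21-0, 2026-08-21);
count-neutral for the binder table (no row).  Lane END-CENTRE, part 4: the EXTREMAL case of `dim_ℚ End⁰(X) ≤ 2 (dim X)²`
— equality iff `X ∼ E^g` for a CM elliptic curve `E`.  Theorems only: no definition, no named fact.
-/
import Summits.HodgeConjecture.CorCM.EndAlgebraMatrixProduct
import Summits.HodgeConjecture.CorCM.Assembly.EllipticCurveEndomorphismAlgebra
import HarnessLib

/-!
# `dim_ℚ End⁰(X) = 2 (dim X)²` iff `X` is isogenous to a power of a CM elliptic curve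

Part 2 of the lane (`CorCM/EndAlgebraMatrixProduct`) proved `dim_ℚ End⁰(X) ≤ 2 (dim X)²` for every complex abelian variety,
through `dim_ℚ End⁰(B) ∣ 2 dim B` for simple `B` (Swinnerton-Dyer 1974 §10 L.44) and `End⁰(X) ≅ ∏ᵢ Mat_{nᵢ+1}(End⁰ Bᵢ)`
(Mumford §19 Cor. 2).  Here the chain of inequalities `Σᵢ (nᵢ+1)² [End⁰Bᵢ:ℚ] ≤ Σᵢ 2(nᵢ+1)² dim Bᵢ ≤ 2 Σᵢ ((nᵢ+1) dim Bᵢ)²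
≤ 2 (Σᵢ (nᵢ+1) dim Bᵢ)²` is read at equality: ONE isotypic component, `dim B = 1`, `[End⁰ B : ℚ] = 2` — i.e. `X ∼ E^{m+1}`
with `E` an elliptic curve with complex multiplication (`dim_ℚ End⁰(E) = 2`, the tree's
`PeriodCurve.finrank_endAlgebra_eq_two_iff_isOfCMType`); conversely `End⁰(E^{m+1}) = Mat_{m+1}(K)` has dimension
`2(m+1)²`.  This is the `End⁰`-analogue of the maximal-Picard-number characterisation (`ρ = g²` iff `X ∼ E^g`, `E` CM).

* `finrank_endAlgebra_of_isIsogenous_power_elliptic` — `X ∼ E^{m+1}`, `dim E = 1`: `dim_ℚ End⁰ X = (m+1)² dim_ℚ End⁰ E`;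
* `finrank_endAlgebra_eq_two_mul_dim_sq_iff` — **`dim_ℚ End⁰(X) = 2 (dim X)²` (`dim X > 0`) iff `X ∼ E^{m+1}` for an
  elliptic curve `E` with `dim_ℚ End⁰(E) = 2`**; `finrank_endAlgebra_eq_two_mul_dim_sq_iff_cm` — the same with «`E` of CM type»;
* `hodgeConjectureFor_of_finrank_endAlgebra_eq_two_mul_dim_sq` — hence the Hodge conjecture for every complex abelian variety
  with maximal `End⁰` (van Geemen Thm. 4.3 for products of elliptic curves, tree theorem; a named known class, not HC_CM).

## References
* [MumfordAV1970] D. Mumford, *Abelian Varieties* (1970), §19 Cor. 2 of Thm. 1 (p. 174).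
* [SwinnertonDyer1974] H. P. F. Swinnerton-Dyer, *Analytic Theory of Abelian Varieties* (1974), §10 Lemma 44.
* [MoonenZarhin1999LowDim] B. Moonen, Yu. Zarhin, Math. Ann. 315 (1999), §2 (2.1) (`End⁰` of elliptic curves), Cor. (3.9).
* [vanGeemen1994HodgeAV] B. van Geemen, *An introduction to the Hodge conjecture for abelian varieties*, LNM 1594 (1994), Thm. 4.3.
-/

noncomputable section

open CategoryTheory CategoryTheory.Limits

namespace Summit.HodgeConjecture.CorCM.CMProductEnd

open Literature.AlgebraicGeometry.Motives Literature.AlgebraicGeometry.Motives.AbelianVariety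
open Literature.AlgebraicGeometry.ComplexMultiplication
open Literature.AlgebraicGeometry.Milne1999 (IsOfCMType IsOfCMTypeSimple)
open Summit.HodgeConjecture.CorCM.AndreRiemann Summit.HodgeConjecture.CorCM.EndAlgebraPower

variable {X : AbelianVariety ℂ}

/-- `dim_ℚ End⁰(X) = (m+1)² · dim_ℚ End⁰(E)` for `X ∼ E^{m+1}` (`End⁰` along the isogeny, then `End⁰(E^{m+1}) ≅
Mat_{m+1}(End⁰ E)`). [cite: MumfordAV1970, §19 Cor. 2 of Thm. 1 (p. 174)] -/
theorem finrank_endAlgebra_of_isIsogenous_power {k : Type} [Field k] {X E : AbelianVariety k} {m : ℕ}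
    (hX : IsIsogenous X (⨁ fun _ : Fin (m + 1) => E)) :
    Module.finrank ℚ X.endAlgebra = (m + 1) ^ 2 * Module.finrank ℚ E.endAlgebra := by
  rw [hX.finrank_endAlgebra_eq, finrank_endAlgebra_biproduct]

/-- **Powers of a CM elliptic curve attain the bound**: if `X ∼ E^{m+1}` with `dim E = 1` and `dim_ℚ End⁰(E) = 2`, then
`dim X = m + 1` and `dim_ℚ End⁰(X) = 2 (m+1)² = 2 (dim X)²`. [cite: MumfordAV1970, §19 Cor. 2 of Thm. 1 (p. 174)] -/
theorem finrank_endAlgebra_eq_two_mul_dim_sq_of_isIsogenous_power {E : AbelianVariety ℂ} {m : ℕ} (hE : E.dim = 1)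
    (hE2 : Module.finrank ℚ E.endAlgebra = 2) (hX : IsIsogenous X (⨁ fun _ : Fin (m + 1) => E)) :
    X.dim = m + 1 ∧ Module.finrank ℚ X.endAlgebra = 2 * X.dim ^ 2 := by
  have hdim : X.dim = m + 1 := by
    obtain ⟨u, hu⟩ := hX
    rw [dim_eq_of_isIsogeny hu, dim_biproduct_const, hE, mul_one]
  refine ⟨hdim, ?_⟩
  rw [finrank_endAlgebra_of_isIsogenous_power hX, hE2, hdim]
  ring

/-- `Σᵢ aᵢ² + 2 a_{i₀} a_{i₁} ≤ (Σᵢ aᵢ)²` for natural numbers and two distinct indices. [folklore] -/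
theorem sum_sq_add_two_mul_le_sq_sum {ι : Type} [Fintype ι] [DecidableEq ι] (a : ι → ℕ) {i₀ i₁ : ι} (hne : i₀ ≠ i₁) :
    ∑ i, a i ^ 2 + 2 * (a i₀ * a i₁) ≤ (∑ i, a i) ^ 2 := by
  have hexp : (∑ i, a i) ^ 2 = ∑ i, ∑ j, a i * a j := by rw [sq, Finset.sum_mul_sum]
  have hin : ∀ i, a i ^ 2 + ((if i = i₀ then a i₀ * a i₁ else 0) + (if i = i₁ then a i₁ * a i₀ else 0))
      ≤ ∑ j, a i * a j := by
    intro i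
    by_cases hi0 : i = i₀
    · subst hi0
      rw [if_pos rfl, if_neg hne, add_zero, sq, ← Finset.sum_pair (f := fun j => a i * a j) hne]
      exact Finset.sum_le_sum_of_subset_of_nonneg (Finset.subset_univ _) fun _ _ _ => Nat.zero_le _
    · by_cases hi1 : i = i₁
      · subst hi1
        rw [if_neg hi0, if_pos rfl, zero_add, sq, ← Finset.sum_pair (f := fun j => a i * a j) (Ne.symm hne)]
        exact Finset.sum_le_sum_of_subset_of_nonneg (Finset.subset_univ _) fun _ _ _ => Nat.zero_le _
      · rw [if_neg hi0, if_neg hi1, add_zero, add_zero, sq]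
        exact Finset.single_le_sum (f := fun j => a i * a j) (fun _ _ => Nat.zero_le _) (Finset.mem_univ i)
  have h := Finset.sum_le_sum fun i (_ : i ∈ Finset.univ) => hin i
  rw [Finset.sum_add_distrib, Finset.sum_add_distrib, Finset.sum_ite_eq' Finset.univ i₀,
    Finset.sum_ite_eq' Finset.univ i₁, if_pos (Finset.mem_univ _), if_pos (Finset.mem_univ _), ← hexp] at h
  rw [mul_comm (a i₁) (a i₀)] at h
  omega

/-- **`dim_ℚ End⁰(X) = 2 (dim X)²` iff `X ∼ E^{m+1}` for an elliptic curve with `dim_ℚ End⁰(E) = 2`** (a complex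
abelian variety of positive dimension).  (`⟹`: in the isotypic decomposition every inequality of the chain behind
`finrank_endAlgebra_le_two_mul_dim_sq` is an equality, forcing one component, `dim B = 1`, `[End⁰ B : ℚ] = 2`.)
[cite: MumfordAV1970, §19 Cor. 1–2 of Thm. 1 (pp. 173–174)] [cite: SwinnertonDyer1974, §10 proof of Lemma 44] -/
theorem finrank_endAlgebra_eq_two_mul_dim_sq_iff (h0 : 0 < X.dim) :
    Module.finrank ℚ X.endAlgebra = 2 * X.dim ^ 2 ↔
      ∃ (E : AbelianVariety ℂ) (m : ℕ), E.dim = 1 ∧ Module.finrank ℚ E.endAlgebra = 2 ∧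
        IsIsogenous X (⨁ fun _ : Fin (m + 1) => E) := by
  classical
  constructor
  · intro heq
    obtain ⟨r, B, n, hS, hd, -, hX, hfin, -⟩ := exists_endAlgebra_structure X
    -- notation: `a i = (nᵢ+1) dim Bᵢ`, `f i = dim_ℚ End⁰ Bᵢ`
    let a : Fin r → ℕ := fun i => (n i + 1) * (B i).dim
    let f : Fin r → ℕ := fun i => Module.finrank ℚ (B i).endAlgebra
    have hdim : X.dim = ∑ i, a i := by
      obtain ⟨u, hu⟩ := hX
      rw [dim_eq_of_isIsogeny hu, dim_biproduct_powers]
    have hfin' : Module.finrank ℚ X.endAlgebra = ∑ i, (n i + 1) ^ 2 * f i := hfin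
    have hpos : ∀ i, 1 ≤ a i := fun i => Nat.mul_pos (Nat.succ_pos _) (hd i)
    have h1 : ∀ i, (n i + 1) ^ 2 * f i ≤ 2 * a i ^ 2 := fun i => by
      have hf := finrank_endAlgebra_le_two_mul_dim_of_isSimple (hS i)
      have h2 : (B i).dim ≤ (B i).dim ^ 2 := by nlinarith [hd i]
      show (n i + 1) ^ 2 * Module.finrank ℚ (B i).endAlgebra ≤ 2 * ((n i + 1) * (B i).dim) ^ 2
      nlinarith [Nat.zero_le (n i)]
    have hsq_le : ∑ i, a i ^ 2 ≤ (∑ i, a i) ^ 2 := sum_sq_le_sq_sum _ a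
    have hS1 : ∑ i, (n i + 1) ^ 2 * f i ≤ ∑ i, 2 * a i ^ 2 := Finset.sum_le_sum fun i _ => h1 i
    have hS2 : ∑ i, 2 * a i ^ 2 = 2 * ∑ i, a i ^ 2 := by rw [Finset.mul_sum]
    rw [hfin', hdim] at heq
    -- all the inequalities are equalities
    have e_f : ∑ i, (n i + 1) ^ 2 * f i = ∑ i, 2 * a i ^ 2 := by omega
    have e_sq : ∑ i, a i ^ 2 = (∑ i, a i) ^ 2 := by omega
    have e1 : ∀ i, (n i + 1) ^ 2 * f i = 2 * a i ^ 2 := fun i =>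
      (Finset.sum_eq_sum_iff_of_le fun j _ => h1 j).1 e_f i (Finset.mem_univ i)
    -- exactly one isotypic component
    have hr : r = 1 := by
      rcases Nat.lt_or_ge r 2 with hlt | hge
      · interval_cases r
        · exfalso
          rw [hdim] at h0
          simp at h0
        · rfl
      · exfalso
        have hne : (⟨0, by omega⟩ : Fin r) ≠ ⟨1, by omega⟩ := fun h => by simp [Fin.ext_iff] at h
        have key := sum_sq_add_two_mul_le_sq_sum a hne
        have hprod : 1 ≤ a ⟨0, by omega⟩ * a ⟨1, by omega⟩ := Nat.mul_pos (hpos _) (hpos _)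
        omega
    subst hr
    -- that component: `dim B = 1`, `[End⁰ B : ℚ] = 2`
    have e0 : (n 0 + 1) ^ 2 * Module.finrank ℚ (B 0).endAlgebra = 2 * ((n 0 + 1) * (B 0).dim) ^ 2 := e1 0
    have hf0 := finrank_endAlgebra_le_two_mul_dim_of_isSimple (hS 0)
    have hd0 := hd 0
    have hn : 0 < (n 0 + 1) ^ 2 := by positivity
    have hB1 : (B 0).dim = 1 := by
      have hle : 2 * ((n 0 + 1) * (B 0).dim) ^ 2 ≤ (n 0 + 1) ^ 2 * (2 * (B 0).dim) := by
        rw [← e0]; exact Nat.mul_le_mul_left _ hf0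
      have hle' : (n 0 + 1) ^ 2 * (2 * (B 0).dim ^ 2) ≤ (n 0 + 1) ^ 2 * (2 * (B 0).dim) := by
        simpa [mul_pow, mul_comm, mul_left_comm, mul_assoc] using hle
      have := Nat.le_of_mul_le_mul_left hle' hn
      nlinarith
    have hB2 : Module.finrank ℚ (B 0).endAlgebra = 2 := by
      have : (n 0 + 1) ^ 2 * Module.finrank ℚ (B 0).endAlgebra = (n 0 + 1) ^ 2 * 2 := by
        rw [e0, hB1]; ring
      exact Nat.eq_of_mul_eq_mul_left hn this
    refine ⟨B 0, n 0, hB1, hB2, hX.trans ?_⟩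
    exact ⟨(biproductUniqueIso fun i : Fin 1 => ⨁ fun _ : Fin (n i + 1) => B i).hom, isIsogeny_hom_of_iso _⟩
  · rintro ⟨E, m, hE, hE2, hX⟩
    exact (finrank_endAlgebra_eq_two_mul_dim_sq_of_isIsogenous_power hE hE2 hX).2

/-- **`dim_ℚ End⁰(X) = 2 (dim X)²` iff `X` is isogenous to a power of an elliptic curve OF CM TYPE** (the tree's
`PeriodCurve.finrank_endAlgebra_eq_two_iff_isOfCMType`: for an elliptic curve, `dim_ℚ End⁰ = 2` iff CM).
[cite: MoonenZarhin1999LowDim, §2 (2.1)] [cite: MumfordAV1970, §19 Cor. 1–2 of Thm. 1 (pp. 173–174)] -/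
theorem finrank_endAlgebra_eq_two_mul_dim_sq_iff_cm (h0 : 0 < X.dim) :
    Module.finrank ℚ X.endAlgebra = 2 * X.dim ^ 2 ↔
      ∃ (E : AbelianVariety ℂ) (m : ℕ), E.dim = 1 ∧ IsOfCMType E ∧ IsIsogenous X (⨁ fun _ : Fin (m + 1) => E) := by
  rw [finrank_endAlgebra_eq_two_mul_dim_sq_iff h0]
  constructor
  · rintro ⟨E, m, hE, hE2, hX⟩
    exact ⟨E, m, hE, (PeriodCurve.finrank_endAlgebra_eq_two_iff_isOfCMType hE).1 hE2, hX⟩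
  · rintro ⟨E, m, hE, hcm, hX⟩
    exact ⟨E, m, hE, (PeriodCurve.finrank_endAlgebra_eq_two_iff_isOfCMType hE).2 hcm, hX⟩

/-- **The Hodge conjecture holds for every complex abelian variety with maximal endomorphism algebra**
(`dim_ℚ End⁰(X) = 2 (dim X)²`, `dim X > 0`): such an `X` is isogenous to a power of a (CM) elliptic curve, and every
abelian variety isogenous to a product of elliptic curves satisfies the Hodge conjecture (Tate ∕ van Geemen Thm. 4.3 ∕
Moonen–Zarhin Cor. 3.9 — the tree's UNCONDITIONAL `vanGeemen1994_thm43_hodgeConjectureFor`).  A named, kernel-closed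
class; nothing here bears on HC_CM. [cite: vanGeemen1994HodgeAV, Thm. 4.3] [cite: MoonenZarhin1999LowDim, Cor. (3.9)] -/
theorem hodgeConjectureFor_of_finrank_endAlgebra_eq_two_mul_dim_sq (h0 : 0 < X.dim)
    (h : Module.finrank ℚ X.endAlgebra = 2 * X.dim ^ 2) :
    Literature.AlgebraicGeometry.HodgeTheory.HodgeConjectureFor X.dim X.X := by
  obtain ⟨E, m, hE, -, hX⟩ := (finrank_endAlgebra_eq_two_mul_dim_sq_iff h0).1 h
  have hX' : IsIsogenous X (Literature.AlgebraicGeometry.HodgeTheory.multiPowSucc 0 (fun _ => E) fun _ => m) :=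
    hX.trans (isIsogenous_biproduct_powSucc E m)
  exact Literature.AlgebraicGeometry.HodgeTheory.vanGeemen1994_thm43_hodgeConjectureFor 0 (fun _ => E) (fun _ => m)
    (fun _ => hE) hX'

end Summit.HodgeConjecture.CorCM.CMProductEnd

end
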